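import Mathlib
import HarnessLib
import Summits.Ventures.LatticeQCDFlow.Scoring.BatchMeansJointCLT
import Summits.Ventures.LatticeQCDFlow.Scoring.GaussianStudentBoundary
import Summits.Ventures.LatticeQCDFlow.Scoring.ReplicaError
import Summits.Ventures.LatticeQCDFlow.Scoring.AsymptoticCoverage

/-!
# BATCH MEANS WITH A FIXED NUMBER OF BATCHES: the estimator converges in law to `σ²_f · χ²_{a−1}/(a−1)`
# (it is NOT consistent) and `x̄ ± z · SE_BM` has STUDENT, not normal, asymptotic coverage

HONEST FRAMING: exact (Metropolis-corrected) sampling algorithms for lattice gauge theory;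
figures of merit are autocorrelation/cost numbers at stated couplings and volumes; no
continuum-physics claim.

Venture `LatticeQCDFlow` (cell pub-lqcd), topic `Scoring`; FANOUT row 4 (`s0-u1-b`, GEN-32).
NEW WORK of the cell, not a published result; no definition is introduced; nothing is cited as a
fact.  The cell's error bars (and binned / jackknife error bars generally) are often computed from a
FIXED number `a` of batches (bins) whose length `b_n` grows with the run.  From the joint CLT of the
batch means (`Scoring/BatchMeansJointCLT.lean`: the vector of `√b_n`-scaled centred batch sums
converges in distribution, from ANY start, to `√σ²_f • Z`, `Z ∼ N(0, I_a)`) this file draws the two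
classical consequences, for every kernel with a geometric sup-norm envelope `(A, ρ)` (every kernel one
of whose powers is Doeblin) and every bounded measurable observable:
(1) the batch-means estimator `σ̂²_{a,b_n} = (a b_n) · SE²_BM` converges IN DISTRIBUTION to
`σ²_f · s²(G)`, `s²(G) = Σ_j (G_j − Ḡ)²/(a−1)` the sample variance of `a` independent standard
Gaussians (`(a−1) s²(G) ∼ χ²_{a−1}`) — a non-degenerate law: at a fixed number of batches the error
bar does not converge to the truth (`chain_batchMeans_sigmaHat_fixedBatches_tendsto_of_envelope`);
(2) if `σ²_f > 0`, `a ≥ 2` and `z ≥ 0`, the probability that the run mean `B̄_n` lies within `z`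
batch-means standard errors of `πf` converges to `P(a · Ḡ² ≤ z² · s²(G))`, i.e. to the two-sided
Student-`t_{a−1}` probability of `[−z, z]` (`T = √a Ḡ/s(G)`), written as the measure of an explicit
event under the product Gaussian law (`chain_batchMeans_fixedBatches_coverage_of_envelope`): the
continuous-mapping theorem for the polynomial `v ↦ a v̄² − z² s²(v)`, then portmanteau on `(−∞, 0]`,
whose frontier `{0}` is null for the limit by `Scoring/GaussianStudentBoundary.lean`.  READING for the
cell's A-vs-B protocol: with few bins the nominal normal quantile under-covers; the calibrated
quantile at a fixed number of bins is Student's.  Printed counterpart NAMED ONLY: the method of batch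
means with a fixed number of batches and its `t_{a−1}` interval (Schmeiser 1982; Glynn–Iglehart
1990; Fishman 1978; Alexopoulos–Goldsman 2004), and the `χ²` limit law named as not typed in
`Literature/Probability/MarkovChains/BatchMeansAsymptotics.lean`; nothing cited as a fact.

## Content (`π` invariant, envelope `(A, ρ)`, `0 ≤ A`, `0 ≤ ρ < 1`; `|f| ≤ C` measurable;
## `P_{μ₀}` from ANY `μ₀`; `G ∼ N(0,1)^{⊗a}` on `Fin a → ℝ`)

* `continuous_euclideanSpace_coord/svar/student`; `batchMeans_sigmaHat_eq_svar`
  (`(b a) · replicaSEsq = s²(V)`), `batchMeans_coverage_iff_student`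
  (`|B̄ − c| ≤ z √SE² ↔ a V̄² − z² s²(V) ≤ 0`);
* **`chain_batchMeans_sigmaHat_fixedBatches_tendsto_of_envelope`** — `σ̂²_n ⇒ σ²_f · s²(G)`;
* **`chain_batchMeans_fixedBatches_coverage_of_envelope`** —
  `P_{μ₀}(|B̄_n − πf| ≤ z·SE_BM,n) → N(0,1)^{⊗a} {g | a ḡ² ≤ z² s²(g)}`.

NOT CLAIMED: the value of the Student probability or its comparison with the normal one; the
two-chain (A-vs-B) version at a fixed number of batches; Doeblin-power restatements (immediate via
`Scoring/DoeblinPowerGeometricEnvelope.lean`); unbounded `f`; any number of ours.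
-/

noncomputable section

namespace Summit.Ventures.LatticeQCDFlow.Scoring

open MeasureTheory ProbabilityTheory Filter Finset Preorder
open scoped ENNReal Topology RealInnerProductSpace

variable {Ω : Type*} [MeasurableSpace Ω]

/-! ### §2 The fixed-`a` statistics as continuous functions of the scaled batch-sum vector -/

section Algebra

/-- The coordinate maps of `EuclideanSpace ℝ (Fin a)` are continuous. -/
theorem continuous_euclideanSpace_coord {a : ℕ} (j : Fin a) :
    Continuous fun v : EuclideanSpace ℝ (Fin a) => v j :=
  (continuous_apply j).comp (PiLp.continuous_ofLp 2 _)

/-- The sample variance of the coordinates, `v ↦ (Σ_j (v_j − v̄)²)/(a − 1)`, is continuous. -/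
theorem continuous_euclidean_svar (a : ℕ) :
    Continuous fun v : EuclideanSpace ℝ (Fin a) =>
      (∑ j, (v j - (∑ i, v i) / (a : ℝ)) ^ 2) / ((a : ℝ) - 1) := by
  have h := fun j : Fin a => continuous_euclideanSpace_coord j
  fun_prop

/-- The Student functional `v ↦ a · v̄² − z² · s²(v)` is continuous. -/
theorem continuous_euclidean_student (a : ℕ) (z : ℝ) :
    Continuous fun v : EuclideanSpace ℝ (Fin a) =>
      (a : ℝ) * ((∑ i, v i) / (a : ℝ)) ^ 2 - z ^ 2 * ((∑ j, (v j - (∑ i, v i) / (a : ℝ)) ^ 2) / ((a : ℝ) - 1)) := by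
  have h := fun j : Fin a => continuous_euclideanSpace_coord j
  fun_prop

/-- **At a fixed number of batches the batch-means estimator IS the sample variance of the scaled
centred batch sums**: with `V_j = (Σ_{r<b} (y_{bj+r} − c))/√b` and `B_j = (Σ_{r<b} y_{bj+r})/b`,
`(b·a) · replicaSEsq B a = (Σ_{j<a} (V_j − V̄)²)/(a − 1)` (`b ≥ 1`; any centring `c`). -/
theorem batchMeans_sigmaHat_eq_svar (y : ℕ → ℝ) (c : ℝ) {a b : ℕ} (hb : 0 < b) :
    (((b * a : ℕ) : ℝ) * replicaSEsq (fun j (_ : Unit) => (∑ i ∈ Finset.range b, y (b * j + i)) / b) a ())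
      = (∑ j ∈ Finset.range a, ((∑ r ∈ Finset.range b, (y (b * j + r) - c)) / Real.sqrt b
          - (∑ i ∈ Finset.range a, (∑ r ∈ Finset.range b, (y (b * i + r) - c)) / Real.sqrt b) / (a : ℝ)) ^ 2)
          / ((a : ℝ) - 1) := by
  have hbR : (0 : ℝ) < b := Nat.cast_pos.2 hb
  have hsb : 0 < Real.sqrt b := Real.sqrt_pos.2 hbR
  have hV : ∀ j, (∑ r ∈ Finset.range b, (y (b * j + r) - c)) / Real.sqrt b
      = Real.sqrt b * ((∑ i ∈ Finset.range b, y (b * j + i)) / b - c) := by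
    intro j
    have hsq : Real.sqrt (b : ℝ) * Real.sqrt b = b := Real.mul_self_sqrt hbR.le
    rw [div_eq_iff hsb.ne', Finset.sum_sub_distrib, Finset.sum_const, Finset.card_range, nsmul_eq_mul]
    have : Real.sqrt (b : ℝ) * ((∑ i ∈ Finset.range b, y (b * j + i)) / b - c) * Real.sqrt b
        = (Real.sqrt (b : ℝ) * Real.sqrt b) * ((∑ i ∈ Finset.range b, y (b * j + i)) / b - c) := by ring
    rw [this, hsq]
    field_simp
  simp_rw [hV]
  unfold replicaSEsq replicaMean
  rcases Nat.lt_or_ge a 2 with ha | ha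
  · interval_cases a
    · simp
    · simp
  have haR : (2 : ℝ) ≤ a := by exact_mod_cast ha
  have ha1 : (a : ℝ) - 1 ≠ 0 := by linarith
  have ha0 : (a : ℝ) ≠ 0 := by linarith
  rw [Nat.cast_mul]
  -- `V_j − V̄ = √b (B_j − B̄)`
  have hdev : ∀ j, Real.sqrt b * ((∑ i ∈ Finset.range b, y (b * j + i)) / b - c)
      - (∑ i ∈ Finset.range a, Real.sqrt b * ((∑ r ∈ Finset.range b, y (b * i + r)) / b - c)) / (a : ℝ)
      = Real.sqrt b * ((∑ i ∈ Finset.range b, y (b * j + i)) / b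
          - (∑ i ∈ Finset.range a, (∑ r ∈ Finset.range b, y (b * i + r)) / b) / (a : ℝ)) := by
    intro j
    rw [← Finset.mul_sum, Finset.sum_sub_distrib, Finset.sum_const, Finset.card_range, nsmul_eq_mul]
    field_simp
    ring
  simp_rw [hdev, mul_pow, Real.sq_sqrt hbR.le, ← Finset.mul_sum]
  field_simp

/-- **The fixed-`a` coverage event is the Student event of the scaled batch-sum vector**:
for `b ≥ 1`, `a ≥ 2`, `z ≥ 0`, `|B̄ − c| ≤ z · √(replicaSEsq B a)` iff `a · V̄² ≤ z² · s²(V)`. -/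
theorem batchMeans_coverage_iff_student (y : ℕ → ℝ) (c : ℝ) {a b : ℕ} (ha : 2 ≤ a) (hb : 0 < b)
    {z : ℝ} (hz : 0 ≤ z) :
    |replicaMean (fun j (_ : Unit) => (∑ i ∈ Finset.range b, y (b * j + i)) / b) a () - c|
        ≤ z * Real.sqrt (replicaSEsq (fun j (_ : Unit) => (∑ i ∈ Finset.range b, y (b * j + i)) / b) a ())
      ↔ (a : ℝ) * ((∑ i ∈ Finset.range a, (∑ r ∈ Finset.range b, (y (b * i + r) - c)) / Real.sqrt b) / (a : ℝ)) ^ 2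
          - z ^ 2 * ((∑ j ∈ Finset.range a, ((∑ r ∈ Finset.range b, (y (b * j + r) - c)) / Real.sqrt b
              - (∑ i ∈ Finset.range a, (∑ r ∈ Finset.range b, (y (b * i + r) - c)) / Real.sqrt b) / (a : ℝ)) ^ 2)
              / ((a : ℝ) - 1)) ≤ 0 := by
  have hbR : (0 : ℝ) < b := Nat.cast_pos.2 hb
  have hsb : 0 < Real.sqrt b := Real.sqrt_pos.2 hbR
  have haR : (2 : ℝ) ≤ a := by exact_mod_cast ha
  have ha1 : (0 : ℝ) < (a : ℝ) - 1 := by linarith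
  have ha0 : (0 : ℝ) < (a : ℝ) := by linarith
  -- the statistic in terms of the batch means
  have hsv := batchMeans_sigmaHat_eq_svar y c (a := a) hb
  set SE2 := replicaSEsq (fun j (_ : Unit) => (∑ i ∈ Finset.range b, y (b * j + i)) / b) a () with hSE2
  set Bbar := replicaMean (fun j (_ : Unit) => (∑ i ∈ Finset.range b, y (b * j + i)) / b) a () with hBbar
  have hSE2nn : 0 ≤ SE2 := by
    simp only [hSE2, replicaSEsq]
    exact div_nonneg (Finset.sum_nonneg fun j _ => sq_nonneg _) (by positivity)
  -- `V̄ = √b (B̄ − c)`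
  have hVbar : (∑ i ∈ Finset.range a, (∑ r ∈ Finset.range b, (y (b * i + r) - c)) / Real.sqrt b) / (a : ℝ)
      = Real.sqrt b * (Bbar - c) := by
    have hV : ∀ j, (∑ r ∈ Finset.range b, (y (b * j + r) - c)) / Real.sqrt b
        = Real.sqrt b * ((∑ i ∈ Finset.range b, y (b * j + i)) / b - c) := by
      intro j
      have hsq : Real.sqrt (b : ℝ) * Real.sqrt b = b := Real.mul_self_sqrt hbR.le
      rw [div_eq_iff hsb.ne', Finset.sum_sub_distrib, Finset.sum_const, Finset.card_range, nsmul_eq_mul]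
      have : Real.sqrt (b : ℝ) * ((∑ i ∈ Finset.range b, y (b * j + i)) / b - c) * Real.sqrt b
          = (Real.sqrt (b : ℝ) * Real.sqrt b) * ((∑ i ∈ Finset.range b, y (b * j + i)) / b - c) := by ring
      rw [this, hsq]
      field_simp
    simp_rw [hV]
    simp only [hBbar, replicaMean]
    rw [← Finset.mul_sum, Finset.sum_sub_distrib, Finset.sum_const, Finset.card_range, nsmul_eq_mul]
    field_simp
  -- the sample variance of `V` is `b a · SE²`
  have hsv' : (∑ j ∈ Finset.range a, ((∑ r ∈ Finset.range b, (y (b * j + r) - c)) / Real.sqrt b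
      - (∑ i ∈ Finset.range a, (∑ r ∈ Finset.range b, (y (b * i + r) - c)) / Real.sqrt b) / (a : ℝ)) ^ 2)
        / ((a : ℝ) - 1) = ((b * a : ℕ) : ℝ) * SE2 := hsv.symm
  rw [hsv', hVbar]
  have hv0 : 0 ≤ z * Real.sqrt SE2 := mul_nonneg hz (Real.sqrt_nonneg SE2)
  have key : |Bbar - c| ≤ z * Real.sqrt SE2 ↔ (Bbar - c) ^ 2 ≤ (z * Real.sqrt SE2) ^ 2 := by
    constructor
    · intro h
      have := pow_le_pow_left₀ (abs_nonneg _) h 2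
      rwa [sq_abs] at this
    · intro h
      exact abs_le_of_sq_le_sq h hv0
  rw [key, mul_pow, Real.sq_sqrt hSE2nn, Nat.cast_mul]
  have hab : (0 : ℝ) < a * b := mul_pos ha0 hbR
  have hsq' : (a : ℝ) * (Real.sqrt b * (Bbar - c)) ^ 2 = (a : ℝ) * b * (Bbar - c) ^ 2 := by
    rw [mul_pow, Real.sq_sqrt hbR.le]; ring
  rw [hsq']
  constructor
  · intro h
    have h2 := mul_le_mul_of_nonneg_left h hab.le
    linarith [h2]
  · intro h
    by_contra hlt
    push Not at hlt
    have h2 := mul_lt_mul_of_pos_left hlt hab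
    linarith [h2]

end Algebra

/-! ### §3 The limit theorems at a fixed number of batches -/

section Envelope

variable {κ : Kernel Ω Ω} [IsMarkovKernel κ] {π : Measure Ω} [IsProbabilityMeasure π] {A ρ : ℝ}

/-- **AT A FIXED NUMBER OF BATCHES THE BATCH-MEANS ESTIMATOR IS NOT CONSISTENT — IT CONVERGES IN
LAW TO `σ²_f · s²(G)`**, `G` a vector of `a` independent standard Gaussians (`(a−1) s²(G) ∼ χ²_{a−1}`):
`π` invariant, envelope `(A, ρ)`, `|f| ≤ C` measurable, `a` fixed, `b_n → ∞`, ANY start `μ₀`. -/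
theorem chain_batchMeans_sigmaHat_fixedBatches_tendsto_of_envelope (hπ : Kernel.Invariant κ π)
    (henv : ∀ (g : Ω → ℝ), Measurable g → ∀ (Cg : ℝ), (∀ x, |g x| ≤ Cg) →
      ∀ (t : ℕ) (x : Ω), |(kop κ)^[t] g x - ∫ y, g y ∂π| ≤ 2 * Cg * (A * ρ ^ t))
    (hA : 0 ≤ A) (hρ0 : 0 ≤ ρ) (hρ1 : ρ < 1)
    {f : Ω → ℝ} (hf : Measurable f) {C : ℝ} (hC : ∀ x, |f x| ≤ C)
    (μ₀ : Measure Ω) [IsProbabilityMeasure μ₀] (a : ℕ) {b : ℕ → ℕ} (hb : Tendsto b atTop atTop)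
    {Ω' : Type*} [MeasurableSpace Ω'] {P' : Measure Ω'} [IsProbabilityMeasure P']
    {G : Ω' → (Fin a → ℝ)} (hG : HasLaw G (Measure.pi fun _ : Fin a => gaussianReal 0 1) P')
    [IsProbabilityMeasure (Kernel.trajMeasure (X := fun _ : ℕ => Ω) (μ₀)
          (fun n : ℕ => κ.comap (fun h' : (i : ↥(Finset.Iic n)) → Ω => h' ⟨n, Finset.mem_Iic.2 le_rfl⟩)
            (measurable_pi_apply _)))] :
    TendstoInDistribution (fun (n : ℕ) (x : ℕ → Ω) =>
        ((b n * a : ℕ) : ℝ) * replicaSEsq (fun j (x : ℕ → Ω) => (∑ i ∈ Finset.range (b n), f (x (b n * j + i))) / (b n)) a x)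
      atTop (fun ω => (((∫ y, (f y - ∫ z, f z ∂(π)) ^ 2 ∂(π)) + 2 * ∑' k, ∫ y, (f y - ∫ z, f z ∂(π)) * (kop (κ))^[k + 1] (fun y => f y - ∫ z, f z ∂(π)) y ∂(π)))
        * ((∑ j, (G ω j - (∑ i, G ω i) / (a : ℝ)) ^ 2) / ((a : ℝ) - 1)))
      (fun _ => (Kernel.trajMeasure (X := fun _ : ℕ => Ω) (μ₀)
            (fun n : ℕ => κ.comap (fun h' : (i : ↥(Finset.Iic n)) → Ω => h' ⟨n, Finset.mem_Iic.2 le_rfl⟩)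
              (measurable_pi_apply _)))) P' := by
  set σ2 : ℝ := ((∫ y, (f y - ∫ z, f z ∂(π)) ^ 2 ∂(π)) + 2 * ∑' k, ∫ y, (f y - ∫ z, f z ∂(π)) * (kop (κ))^[k + 1] (fun y => f y - ∫ z, f z ∂(π)) y ∂(π)) with hσ2
  have hσ2nn : 0 ≤ σ2 := greenKubo_nonneg_of_envelope hπ henv hρ0 hρ1 hf hC
  have hZ := hasLaw_toLp_of_hasLaw_pi_gaussianReal hG
  have hJ := chain_batchMeans_joint_clt_of_envelope hπ henv hA hρ0 hρ1 hf hC μ₀ a hb hZ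
  have hcont := hJ.continuous_comp (continuous_euclidean_svar a)
  refine hcont.congr (fun n => ae_of_all _ fun x => ?_) (ae_of_all _ fun ω => ?_)
  · -- `s²(V_n) = (b_n a) · SE²_BM`
    show (∑ j : Fin a, ((WithLp.toLp 2 (fun j : Fin a =>
          (∑ r ∈ Finset.range (b n), (f (x (b n * j + r)) - ∫ z, f z ∂π)) / Real.sqrt (b n)) : EuclideanSpace ℝ (Fin a)) j
          - (∑ i : Fin a, (WithLp.toLp 2 (fun j : Fin a =>
          (∑ r ∈ Finset.range (b n), (f (x (b n * j + r)) - ∫ z, f z ∂π)) / Real.sqrt (b n)) : EuclideanSpace ℝ (Fin a)) i) / (a : ℝ)) ^ 2)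
          / ((a : ℝ) - 1)
      = ((b n * a : ℕ) : ℝ) * replicaSEsq (fun j (x : ℕ → Ω) => (∑ i ∈ Finset.range (b n), f (x (b n * j + i))) / (b n)) a x
    dsimp only
    rcases Nat.eq_zero_or_pos (b n) with hb0 | hb0
    · simp [hb0, replicaSEsq, replicaMean]
    rw [Fin.sum_univ_eq_sum_range (fun i => (∑ r ∈ Finset.range (b n), (f (x (b n * i + r)) - ∫ z, f z ∂π)) / Real.sqrt (b n)) a,
      Fin.sum_univ_eq_sum_range (fun j => ((∑ r ∈ Finset.range (b n), (f (x (b n * j + r)) - ∫ z, f z ∂π)) / Real.sqrt (b n)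
        - (∑ i ∈ Finset.range a, (∑ r ∈ Finset.range (b n), (f (x (b n * i + r)) - ∫ z, f z ∂π)) / Real.sqrt (b n)) / (a : ℝ)) ^ 2) a]
    exact (batchMeans_sigmaHat_eq_svar (fun t => f (x t)) (∫ z, f z ∂π) (a := a) hb0).symm
  · -- `s²(√σ² • G) = σ² · s²(G)`
    show (∑ j : Fin a, ((Real.sqrt σ2 • (WithLp.toLp 2 (G ω) : EuclideanSpace ℝ (Fin a))) j
          - (∑ i : Fin a, (Real.sqrt σ2 • (WithLp.toLp 2 (G ω) : EuclideanSpace ℝ (Fin a))) i) / (a : ℝ)) ^ 2)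
          / ((a : ℝ) - 1)
      = σ2 * ((∑ j, (G ω j - (∑ i, G ω i) / (a : ℝ)) ^ 2) / ((a : ℝ) - 1))
    simp only [PiLp.smul_apply, smul_eq_mul]
    have : ∀ j : Fin a, Real.sqrt σ2 * G ω j - (∑ i, Real.sqrt σ2 * G ω i) / (a : ℝ)
        = Real.sqrt σ2 * (G ω j - (∑ i, G ω i) / (a : ℝ)) := fun j => by
      rw [← Finset.mul_sum]; ring
    simp_rw [this, mul_pow, Real.sq_sqrt hσ2nn, ← Finset.mul_sum]
    ring

/-- **THE STUDENT CALIBRATION OF THE BATCH-MEANS INTERVAL AT A FIXED NUMBER OF BATCHES.**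
`π` invariant, envelope `(A, ρ)`, `|f| ≤ C` measurable with `σ²_f > 0`; `a ≥ 2` FIXED batches of
length `b_n → ∞`; `z ≥ 0`; ANY start `μ₀`; `G` a vector of `a` independent standard Gaussians.  Then
the probability that the overall mean lies within `z` batch-means standard errors of `πf` converges
to `P(a · Ḡ² ≤ z² · s²(G))` — the two-sided Student-`t_{a−1}` probability of `[−z, z]`, NOT the
normal one: `P_{μ₀}(|B̄_n − πf| ≤ z · SE_BM,n) → P(|T_{a−1}| ≤ z)`. -/
theorem chain_batchMeans_fixedBatches_coverage_of_envelope (hπ : Kernel.Invariant κ π)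
    (henv : ∀ (g : Ω → ℝ), Measurable g → ∀ (Cg : ℝ), (∀ x, |g x| ≤ Cg) →
      ∀ (t : ℕ) (x : Ω), |(kop κ)^[t] g x - ∫ y, g y ∂π| ≤ 2 * Cg * (A * ρ ^ t))
    (hA : 0 ≤ A) (hρ0 : 0 ≤ ρ) (hρ1 : ρ < 1)
    {f : Ω → ℝ} (hf : Measurable f) {C : ℝ} (hC : ∀ x, |f x| ≤ C)
    (hσ : 0 < ((∫ y, (f y - ∫ z, f z ∂(π)) ^ 2 ∂(π)) + 2 * ∑' k, ∫ y, (f y - ∫ z, f z ∂(π)) * (kop (κ))^[k + 1] (fun y => f y - ∫ z, f z ∂(π)) y ∂(π)))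
    (μ₀ : Measure Ω) [IsProbabilityMeasure μ₀] {a : ℕ} (ha : 2 ≤ a) {b : ℕ → ℕ}
    (hb : Tendsto b atTop atTop) {z : ℝ} (hz : 0 ≤ z)
    {Ω' : Type*} [MeasurableSpace Ω'] {P' : Measure Ω'} [IsProbabilityMeasure P']
    {G : Ω' → (Fin a → ℝ)} (hG : HasLaw G (Measure.pi fun _ : Fin a => gaussianReal 0 1) P')
    [IsProbabilityMeasure (Kernel.trajMeasure (X := fun _ : ℕ => Ω) (μ₀)
          (fun n : ℕ => κ.comap (fun h' : (i : ↥(Finset.Iic n)) → Ω => h' ⟨n, Finset.mem_Iic.2 le_rfl⟩)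
            (measurable_pi_apply _)))] :
    Tendsto (fun n => (Kernel.trajMeasure (X := fun _ : ℕ => Ω) (μ₀)
            (fun n : ℕ => κ.comap (fun h' : (i : ↥(Finset.Iic n)) → Ω => h' ⟨n, Finset.mem_Iic.2 le_rfl⟩)
              (measurable_pi_apply _))).real
        {x : ℕ → Ω | |replicaMean (fun j (x : ℕ → Ω) => (∑ i ∈ Finset.range (b n), f (x (b n * j + i))) / (b n)) a x - ∫ z, f z ∂π|
            ≤ z * Real.sqrt (replicaSEsq (fun j (x : ℕ → Ω) => (∑ i ∈ Finset.range (b n), f (x (b n * j + i))) / (b n)) a x)})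
      atTop (𝓝 ((Measure.pi fun _ : Fin a => gaussianReal 0 1).real
        {g : Fin a → ℝ | (a : ℝ) * ((∑ i, g i) / (a : ℝ)) ^ 2
            ≤ z ^ 2 * ((∑ j, (g j - (∑ i, g i) / (a : ℝ)) ^ 2) / ((a : ℝ) - 1))})) := by
  obtain ⟨k, rfl⟩ := Nat.exists_eq_succ_of_ne_zero (show a ≠ 0 by omega)
  have hk : 1 ≤ k := by omega
  set P := (Kernel.trajMeasure (X := fun _ : ℕ => Ω) (μ₀)
        (fun n : ℕ => κ.comap (fun h' : (i : ↥(Finset.Iic n)) → Ω => h' ⟨n, Finset.mem_Iic.2 le_rfl⟩)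
          (measurable_pi_apply _))) with hP
  set σ2 : ℝ := ((∫ y, (f y - ∫ z, f z ∂(π)) ^ 2 ∂(π)) + 2 * ∑' k, ∫ y, (f y - ∫ z, f z ∂(π)) * (kop (κ))^[k + 1] (fun y => f y - ∫ z, f z ∂(π)) y ∂(π)) with hσ2
  have hσ2nn : 0 ≤ σ2 := hσ.le
  have hZ := hasLaw_toLp_of_hasLaw_pi_gaussianReal hG
  have hJ := chain_batchMeans_joint_clt_of_envelope hπ henv hA hρ0 hρ1 hf hC μ₀ (k + 1) hb hZ
  -- the Student functional of the scaled batch-sum vector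
  have hcont := hJ.continuous_comp (continuous_euclidean_student (k + 1) z)
  -- its limit is `σ² · h₀(G)`
  set h₀ : (Fin (k + 1) → ℝ) → ℝ := fun g => ((k + 1 : ℕ) : ℝ) * ((∑ i, g i) / ((k + 1 : ℕ) : ℝ)) ^ 2
      - z ^ 2 * ((∑ j, (g j - (∑ i, g i) / ((k + 1 : ℕ) : ℝ)) ^ 2) / (((k + 1 : ℕ) : ℝ) - 1)) with hh₀
  have hh₀m : Measurable h₀ := by
    simp only [hh₀]
    fun_prop
  have hlim : ∀ ω, ((fun v : EuclideanSpace ℝ (Fin (k + 1)) =>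
      ((k + 1 : ℕ) : ℝ) * ((∑ i, v i) / ((k + 1 : ℕ) : ℝ)) ^ 2
        - z ^ 2 * ((∑ j, (v j - (∑ i, v i) / ((k + 1 : ℕ) : ℝ)) ^ 2) / (((k + 1 : ℕ) : ℝ) - 1))) ∘
      (fun ω => Real.sqrt σ2 • (WithLp.toLp 2 (G ω) : EuclideanSpace ℝ (Fin (k + 1))))) ω
      = σ2 * h₀ (G ω) := by
    intro ω
    simp only [Function.comp, PiLp.smul_apply, smul_eq_mul, hh₀]
    have e1 : ∑ i, Real.sqrt σ2 * G ω i = Real.sqrt σ2 * ∑ i, G ω i := by rw [Finset.mul_sum]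
    have e2 : ∀ j : Fin (k + 1), Real.sqrt σ2 * G ω j - Real.sqrt σ2 * (∑ i, G ω i) / ((k + 1 : ℕ) : ℝ)
        = Real.sqrt σ2 * (G ω j - (∑ i, G ω i) / ((k + 1 : ℕ) : ℝ)) := fun j => by ring
    rw [e1]
    simp_rw [e2, mul_pow, Real.sq_sqrt hσ2nn, ← Finset.mul_sum]
    have e3 : (Real.sqrt σ2 * ∑ i, G ω i) / ((k + 1 : ℕ) : ℝ) = Real.sqrt σ2 * ((∑ i, G ω i) / ((k + 1 : ℕ) : ℝ)) := by
      ring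
    rw [e3, mul_pow, Real.sq_sqrt hσ2nn]
    ring
  have hclt := hcont.congr (fun n => ae_of_all _ fun x => rfl) (ae_of_all _ hlim)
  -- portmanteau on `(−∞, 0]`, whose frontier `{0}` is null for the limit
  have hZm : AEMeasurable (fun ω => σ2 * h₀ (G ω)) P' :=
    (hh₀m.comp_aemeasurable hG.aemeasurable).const_mul σ2
  have hfr : (P'.map (fun ω => σ2 * h₀ (G ω))) (frontier (Set.Iic (0 : ℝ))) = 0 := by
    rw [frontier_Iic, Measure.map_apply_of_aemeasurable hZm (measurableSet_singleton 0)]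
    have hset : (fun ω => σ2 * h₀ (G ω)) ⁻¹' {0} = G ⁻¹' {g | h₀ g = 0} := by
      ext ω
      simp only [Set.mem_preimage, Set.mem_singleton_iff, Set.mem_setOf_eq, mul_eq_zero, hσ.ne', false_or]
    have hE0 : MeasurableSet {g : Fin (k + 1) → ℝ | h₀ g = 0} := hh₀m (measurableSet_singleton 0)
    rw [hset, ← Measure.map_apply_of_aemeasurable hG.aemeasurable hE0, hG.map_eq]
    exact pi_gaussianReal_studentBoundary_eq_zero k hk z
  have key := CardConsistency.tendsto_measureReal_preimage_of_tendstoInDistribution hclt measurableSet_Iic hfr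
  -- identify the events
  have hlimset : P'.real ((fun ω => σ2 * h₀ (G ω)) ⁻¹' Set.Iic 0)
      = (Measure.pi fun _ : Fin (k + 1) => gaussianReal 0 1).real
        {g : Fin (k + 1) → ℝ | ((k + 1 : ℕ) : ℝ) * ((∑ i, g i) / ((k + 1 : ℕ) : ℝ)) ^ 2
            ≤ z ^ 2 * ((∑ j, (g j - (∑ i, g i) / ((k + 1 : ℕ) : ℝ)) ^ 2) / (((k + 1 : ℕ) : ℝ) - 1))} := by
    have hset : (fun ω => σ2 * h₀ (G ω)) ⁻¹' Set.Iic 0 = G ⁻¹' {g | h₀ g ≤ 0} := by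
      ext ω
      simp only [Set.mem_preimage, Set.mem_Iic, Set.mem_setOf_eq]
      constructor
      · intro h; nlinarith [hσ]
      · intro h; nlinarith [hσ]
    have hE : MeasurableSet {g : Fin (k + 1) → ℝ | h₀ g ≤ 0} := hh₀m measurableSet_Iic
    rw [hset, measureReal_def, measureReal_def, ← Measure.map_apply_of_aemeasurable hG.aemeasurable hE,
      hG.map_eq]
    congr 1
    congr 1
    ext g
    simp only [Set.mem_setOf_eq, hh₀, sub_nonpos]
  rw [hlimset] at key
  refine key.congr' ?_
  filter_upwards [hb.eventually_gt_atTop 0] with n hn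
  congr 1
  ext x
  simp only [Set.mem_preimage, Set.mem_Iic, Set.mem_setOf_eq, Function.comp]
  rw [Fin.sum_univ_eq_sum_range (fun i => (∑ r ∈ Finset.range (b n), (f (x (b n * i + r)) - ∫ z, f z ∂π)) / Real.sqrt (b n)) (k + 1),
    Fin.sum_univ_eq_sum_range (fun j => ((∑ r ∈ Finset.range (b n), (f (x (b n * j + r)) - ∫ z, f z ∂π)) / Real.sqrt (b n)
      - (∑ i ∈ Finset.range (k + 1), (∑ r ∈ Finset.range (b n), (f (x (b n * i + r)) - ∫ z, f z ∂π)) / Real.sqrt (b n)) / ((k + 1 : ℕ) : ℝ)) ^ 2) (k + 1)]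
  exact (batchMeans_coverage_iff_student (fun t => f (x t)) (∫ z, f z ∂π) ha hn hz).symm

end Envelope

end Summit.Ventures.LatticeQCDFlow.Scoring

end
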